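import Mathlib
import Literature.MathematicalPhysics.QuantumFieldTheory.Borinsky2020.GeneralizedPermutahedronVertex
import HarnessLib

/-!
# Corollary 24 of Borinsky 2020: `z₁ > z₂` on the non-empty proper subsets and `z₁([n]) = z₂([n])` put `𝒢_{z₁}` inside the RELATIVE INTERIOR of `𝒢_{z₂}` (AIHPD 2023 = arXiv:2008.12310, §6.1 Corollary 24) — PROVED, with Mathlib's `intrinsicInterior`

independent recomputation; certified where stated, statistical where stated; no new-physics claim.

CITATION HEADER (venture `QEDPrecision`, cell `pub-qed`, track TROPICAL, LIT seat `pub-qed-trop-lit` gen 25; VALUE-FREE: an inclusion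
between abstract polytopes — no Feynman graph, no integral, nothing per word or per Set V family). Completes the companion
`Borinsky2020/GeneralizedPermutahedronVertex.lean`, whose `gpPolytope_mono` types the INCLUSION half of Corollary 24 and whose header
records "the relative-interior refinement is not typed". It is the link between the generalized-permutahedron language of §6 (the
boolean functions `z_𝒜`, `z_ℬ` and `r(A) = z_𝒜(A) − z_ℬ(A)` of eq. (40)) and requirement R2 `𝒜 ⊂ relint ℬ` of the
convergence Theorem 3 as typed in the companion `Borinsky2020/ConvergenceTheorem.lean` (`𝒜 ⊆ intrinsicInterior ℝ ℬ`).

Source [Borinsky2020]: M. Borinsky, "Tropical Monte Carlo quadrature for Feynman integrals", Ann. Inst. Henri Poincaré D 10 (2023) 635–685,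
doi:10.4171/aihpd/158 = arXiv:2008.12310v2 (LaTeX e-print held by the cell, HOME `data/lit/sources/.cache/2008.12310/tropical.tex`; flat
e-print theorem counter as in the companions; journal: Corollary 24 = AIHPD 10 Cor. 6.3). VERBATIM. Theorem 23 (tex l.1015–1022):
"A generalized permutahedron 𝒢_z has the facet presentation 𝒢_z = { v ∈ ℝⁿ : Σ_{i∈[n]} v_i = z([n]) and Σ_{i∈I} v_i ≥ z(I) for all
I ⊂ [n] }, (39) where [n] = {1,…,n} and z is a supermodular boolean function z : 2^[n] → ℝ with z(∅) = 0." **Corollary 24**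
(l.1024–1033): "If both 𝒢_{z_1} and 𝒢_{z_2} are generalized permutahedra and z_1(A) > z_2(A) for all non-empty A ⊊ [n] and
z_1([n]) = z_2([n]), then 𝒢_{z_1} ⊂ relint 𝒢_{z_2}." with the proof "By Theorem 23 it follows immediately that 𝒢_{z_1} ⊂ 𝒢_{z_2}. The
inequalities in eq. (39) are strict [Aguiar–Ardila, Theorem 12.3]. Therefore the statement follows." Used in Theorem 27 (l.1063–1066:
"such that 𝒜 = Σ_i Re ν_i NP_{a_i} and ℬ = Σ_j Re ρ_j NP_{b_j} are generalized permutahedra … with the associated boolean functions z_𝒜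
and z_ℬ … which fulfill the requirements R1–R3 of Theorem 3") and in §6.2 eq. (40) (l.1104–1106: "r(A) = z_𝒜(A) − z_ℬ(A) … r(A) > 0
for all non-empty proper subsets A ⊊ [n]" — companion `SectorTableRecursion.lean`): with `z_1 = z_𝒜`, `z_2 = z_ℬ` the hypothesis of
Corollary 24 is exactly `r(A) > 0` for every non-empty proper `A` together with `z_𝒜([n]) = z_ℬ([n])`, and its conclusion is
requirement R2 for generalized permutahedra (in eq. (39) a larger `z` cuts out a smaller polytope).

TYPING. As in the companion: ground set `Fin n`, `gpPolytope z = {v | Σ_i v_i = z univ ∧ ∀ I, z I ≤ Σ_{i∈I} v_i}` (eq. (39) taken as the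
definition of `𝒢_z`); "relint" = Mathlib's `intrinsicInterior ℝ` (the interior inside the affine span); the printed standing convention
`z(∅) = 0` of Theorem 23 enters as the hypothesis `z₂ ∅ = 0` (eq. (39) with `I = ∅` reads `z(∅) ≤ 0`). The printed hypothesis "both
are generalized permutahedra" (supermodularity of `z_1`, `z_2`) is NOT needed for the inclusion into the relative interior and is not
assumed: the typed statement is Corollary 24 for arbitrary boolean functions. PROOF: the printed one — `𝒢_{z_1} ⊂ 𝒢_{z_2}` and the
defining inequalities of `𝒢_{z_2}` are STRICT at every point of `𝒢_{z_1}`; strictness of finitely many continuous constraints is an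
open condition inside the affine hull `aff 𝒢_{z_2} ⊂ {Σ_i v_i = z_2([n])}` (`sum_eq_of_mem_affineSpan_gpPolytope`), on which the
equality constraint holds identically.

PROVED (0 named facts, D-0026; Mathlib + the companion file only): `sum_eq_of_mem_affineSpan_gpPolytope` (the affine hull of `𝒢_z`
lies in the hyperplane `Σ_i v_i = z([n])`), **`gpPolytope_subset_intrinsicInterior`** (= Corollary 24: `z₂ ∅ = 0`, `z₂ I < z₁ I` for
non-empty proper `I`, `z₁ univ = z₂ univ` ⇒ `gpPolytope z₁ ⊆ intrinsicInterior ℝ (gpPolytope z₂)`), and the point form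
`mem_intrinsicInterior_gpPolytope_of_forall_lt` (a point of `𝒢_z` at which every proper inequality is strict lies in `relint 𝒢_z` —
the sentence "The inequalities in eq. (39) are strict … Therefore the statement follows"). NOT typed: Theorem 23 as an equivalence
(normal fan coarsening the braid fan ⟺ facet presentation), the reverse half of Lemma 25, requirement R1 for `𝒢_z` (when `𝒢_z` is
(n−1)-dimensional), Theorem 27 / Theorem 34. (Filed by the pub-qed TROPICAL literature seat `pub-qed-trop-lit` gen 25;
`tropical/lit/SOURCES.md` A24 / A25.)
-/

noncomputable section

open Finset

namespace Literature.MathematicalPhysics.QuantumFieldTheory.Borinsky2020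

variable {n : ℕ}

/-- The affine hull of `𝒢_z` lies in the hyperplane of eq. (39)'s equality constraint: every `w ∈ aff 𝒢_z` has `Σ_i w_i = z([n])`
("𝒢_z = { v ∈ ℝⁿ : Σ_{i∈[n]} v_i = z([n]) and … }"). [cite: Borinsky2020, Theorem 23 eq. (39) (tropical.tex l.1016–1018)] -/
theorem sum_eq_of_mem_affineSpan_gpPolytope {z : Finset (Fin n) → ℝ} {w : Fin n → ℝ}
    (hw : w ∈ affineSpan ℝ (gpPolytope z)) : ∑ i, w i = z univ := by
  refine affineSpan_induction (p := fun w : Fin n → ℝ => ∑ i, w i = z univ) hw (fun x hx => (mem_gpPolytope.mp hx).1) ?_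
  intro c u v w' hu hv hw'
  simp only [vsub_eq_sub, vadd_eq_add, Pi.add_apply, Pi.smul_apply, Pi.sub_apply, smul_eq_mul, sum_add_distrib,
    ← mul_sum, sum_sub_distrib, hu, hv, hw', sub_self, mul_zero, zero_add]

/-- **"The inequalities in eq. (39) are strict … Therefore the statement follows"**: a point `v ∈ 𝒢_z` at which every inequality
`Σ_{i∈I} v_i ≥ z(I)` with `I` non-empty and proper is STRICT lies in the relative interior `relint 𝒢_z` (Mathlib: `intrinsicInterior`).
Strictness of finitely many continuous constraints is an open condition in the affine hull, on which `Σ_i v_i = z([n])` holds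
identically and the constraints for `I = ∅` (`z(∅) = 0`) and `I = [n]` are automatic. [cite: Borinsky2020, proof of Corollary 24 (tropical.tex l.1030–1033)] -/
theorem mem_intrinsicInterior_gpPolytope_of_forall_lt {z : Finset (Fin n) → ℝ} (h0 : z ∅ = 0) {v : Fin n → ℝ}
    (hv : v ∈ gpPolytope z) (hlt : ∀ I : Finset (Fin n), I.Nonempty → I ≠ univ → z I < ∑ i ∈ I, v i) :
    v ∈ intrinsicInterior ℝ (gpPolytope z) := by
  classical
  rw [mem_intrinsicInterior]
  refine ⟨⟨v, subset_affineSpan ℝ _ hv⟩, ?_, rfl⟩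
  -- the open set of the affine hull on which the proper inequalities are strict
  set P : Finset (Finset (Fin n)) := univ.filter fun I => I.Nonempty ∧ I ≠ univ with hP
  set U : Set (affineSpan ℝ (gpPolytope z)) :=
    ⋂ I ∈ P, {w : affineSpan ℝ (gpPolytope z) | z I < ∑ i ∈ I, (w : Fin n → ℝ) i} with hU
  have hUopen : IsOpen U := by
    refine isOpen_biInter_finset fun I _ => ?_
    exact isOpen_lt continuous_const
      (continuous_finsetSum _ fun i _ => (continuous_apply i).comp continuous_subtype_val)
  have hvU : (⟨v, subset_affineSpan ℝ _ hv⟩ : affineSpan ℝ (gpPolytope z)) ∈ U := by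
    simp only [hU, Set.mem_iInter, Set.mem_setOf_eq]
    intro I hI
    obtain ⟨-, hI1, hI2⟩ := mem_filter.mp hI
    exact hlt I hI1 hI2
  have hUsub : U ⊆ ((↑) : affineSpan ℝ (gpPolytope z) → Fin n → ℝ) ⁻¹' gpPolytope z := by
    intro w hw
    simp only [hU, Set.mem_iInter, Set.mem_setOf_eq] at hw
    refine mem_gpPolytope.mpr ⟨sum_eq_of_mem_affineSpan_gpPolytope w.2, fun I => ?_⟩
    by_cases hI1 : I.Nonempty
    · by_cases hI2 : I = univ
      · rw [hI2, sum_eq_of_mem_affineSpan_gpPolytope w.2]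
      · exact (hw I (mem_filter.mpr ⟨mem_univ _, hI1, hI2⟩)).le
    · rw [not_nonempty_iff_eq_empty.mp hI1, h0, sum_empty]
  exact mem_interior.mpr ⟨U, hUsub, hUopen, hvU⟩

/-- **Corollary 24** (relative-interior form): "If … z_1(A) > z_2(A) for all non-empty A ⊊ [n] and z_1([n]) = z_2([n]), then
𝒢_{z_1} ⊂ relint 𝒢_{z_2}." — with `z_2(∅) = 0` (Theorem 23's standing convention) and WITHOUT the printed hypothesis that the two
polytopes be generalized permutahedra (supermodularity is not used). With `z_1 = z_𝒜`, `z_2 = z_ℬ` the hypothesis is §6.2's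
`r(A) = z_𝒜(A) − z_ℬ(A) > 0` on non-empty proper `A` (eq. (40)) and the conclusion is requirement R2 of Theorem 3 for generalized
permutahedra.
[cite: Borinsky2020, Corollary 24 (tropical.tex l.1024–1033)] -/
theorem gpPolytope_subset_intrinsicInterior {z₁ z₂ : Finset (Fin n) → ℝ} (h0 : z₂ ∅ = 0)
    (h : ∀ I : Finset (Fin n), I.Nonempty → I ≠ univ → z₂ I < z₁ I) (htop : z₁ univ = z₂ univ) :
    gpPolytope z₁ ⊆ intrinsicInterior ℝ (gpPolytope z₂) := by
  intro v hv
  have hv' := mem_gpPolytope.mp hv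
  have hv2 : v ∈ gpPolytope z₂ := by
    refine mem_gpPolytope.mpr ⟨hv'.1.trans htop, fun I => ?_⟩
    by_cases hI1 : I.Nonempty
    · by_cases hI2 : I = univ
      · rw [hI2, hv'.1, htop]
      · exact ((h I hI1 hI2).trans_le (hv'.2 I)).le
    · rw [not_nonempty_iff_eq_empty.mp hI1, h0, sum_empty]
  exact mem_intrinsicInterior_gpPolytope_of_forall_lt h0 hv2 fun I hI1 hI2 => (h I hI1 hI2).trans_le (hv'.2 I)

end Literature.MathematicalPhysics.QuantumFieldTheory.Borinsky2020

end
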